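/-
Copyright (c) 2026 the pub-hodgecm-mathlib formalisation cell (harness21).  Prover seat hodgecm-mathlib-F0P2-p01 (g15): road «S3-ram» (LEAD F0P3a-plan (g12); architect
A-p16 (g31) deal (a1) «SHELL RECURSION over the fixed-child criterion», 22:55:02Z «make the class token FRAME-INTRINSIC»; owner F0P3a-p06 (g15)), organ A′ (ii)
«the CLASS TOKEN of a fixed child»; 2026-09-01.
-/
import Literature.NumberTheory.Automorphic.UnitaryLatticeTreeFixedChildLevelRamified   -- ★ p847102 (this seat): child frame `g(a,b)`, `childFrame_conj_eq`, the depth law; brings ★ p847085, ★ p847060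
import HarnessLib

/-!
# The lattice graph of a hermitian space — THE SQUARE-CLASS TOKEN OF A FIXED CHILD AT A TAME-RAMIFIED PLACE IS FRAME-INTRINSIC: on the dual box of the modular
# neighbour the form `y ↦ B₀(y, (γ−1)y)` is `−B₀(x, (γ−1)x)·u₀²` to order `d − 2` (Bruhat–Tits 1972 §10; Tits 1979 §3.5; Kottwitz 1986 §3)

Topic `NumberTheory/Automorphic`; namespace `Literature.NumberTheory.Automorphic.UnitaryLatticeTree`.  THEOREMS ONLY (no definition, no instance, no notation, no named fact,
no `sorry`); kernel lane `--supports stmt-HodgeConjecture-24833`.  Cell `pub/hodgecm-mathlib` (D-0151), crux H413; road «S3-ram» (Literature seeding, count-neutral), organ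
A′ (ii) of the P-1-ram skeleton (architect A-p16 (g31), ROAD-P1ram), deal (a1) third file: ★ p847085 = the COUNT of fixed children, ★ p847102 = their DEPTH, THIS = their
CLASS (and the second-order expansion of the conjugate that carries the drop-1 RANK).  DATUM-FREE (`K` with `Valued K ℤᵐ⁰`; §1 needs NO hypothesis on `σ`; §2–§3 use `σ`
valuation-preserving, `σϖ = −ϖ` and `σ` residually trivial — the tame-ramified tokens `hvσ`, `hσϖ`, `hres` of ★ R3 ∕ ★ p847085).  Tokens of ★ `UnitaryLatticeTree*`:
`L₀ = 𝒪³`, `N₁ = latt diag(1,1,ϖ)` (the modular neighbour), `N₁^♯ = latt diag(ϖ⁻¹,1,1)` (★ `dualLatt_N₁_of_v`) = the DUAL BOX `{u : |ϖu₀| ≤ 1, |u₁| ≤ 1, |u₂| ≤ 1}`, which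
contains `L₀` and all `q` children `N₁ + 𝒪w(a,b)`, `w(a,b) = (a∕ϖ, 0, b)`, `|a| = 1`; child frame `g(a,b) = !![a∕ϖ, 0, 0; 0, 1, 0; b, 0, ϖ]` (★ p847102 §1).

THE MATHEMATICS.  Let `γ` fix the self-dual vertex `κ·L₀` (`κ` unitary) with `M := κ⁻¹(γ−1)κ` of level `ϖ^d` (`|M_{ij}| ≤ |ϖ|^d`), so that `M₂₀ = B₀(x, (γ−1)x)`, `x = κe₀`
(★ `inv_mul_mul_apply_two_zero_eq_B₀`) is the value of the residual form `Q_Ȳ` on the isotropic line `x̄` of the modular neighbour `κ·N₁`.  §1 refines ★ `childFrame_conj_eq`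
to SECOND ORDER: `g⁻¹Mg = L + (entries ≤ |ϖ|^d)` with the strictly lower-triangular LEADING PART `L = !![0,0,0; (a∕ϖ)M₁₀, 0, 0; (a∕ϖ²)M₂₀ + (b∕ϖ)(M₂₂−M₀₀), ϖ⁻¹M₂₁, 0]`
(`v_childFrame_conj_sub_lower_le`, every `d`), hence to FIRST ORDER `g⁻¹Mg = (a∕ϖ²)M₂₀·E₂₀ + (entries ≤ |ϖ|^{d−1})` (`v_childFrame_conj_sub_corner_le`, `d ≥ 1`): the child's
order-`(d−2)` residual matrix is the CORNER `(aϖ^{−d}M₂₀)·E₂₀` — rank `≤ 1`, the corner type `N(c)` of ★ p847096 — and, when the corner passes (`|M₂₀| ≤ |ϖ|^{d+1}`), its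
order-`(d−1)` matrix is `ϖ^{1−d}L mod ϖ = !![0,0,0; āȳ₁₀,0,0; ∗, ȳ₂₁, 0]`, of rank `2` iff `ȳ₁₀ ≠ 0` (`ȳ₂₁ = ±ȳ₁₀` by the parity of `J̄₀Ȳ`) iff `x̄ ∉ ker Ȳ` (the drop-1 RANK
law: the kernel ∕ radical line is the inward one).  §2 is the form-level statement WITHOUT child coordinates: for every `u` in the dual box, `B₀(u, Mu) = σ(u₀)u₀·M₂₀ + (≤ |ϖ|^{d−1})`
(`v_B₀_mulVec_sub_leading_le`; ★ p847102's `v_B₀_childVec_sub_le` is `u = w(a,b)`), and since `σ(u₀)u₀ = N(ϖu₀)∕N(ϖ) = −N(ϖu₀)∕ϖ²` with NORMS RESIDUALLY SQUARES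
(`v_sigma_mul_self_sub_sq_lt`: `|σz·z − z²| < 1` for `|z| ≤ 1`), **`|B₀(u, Mu) + u₀²·M₂₀| < |ϖ|^{d−2}`** (`v_B₀_mulVec_add_sq_mul_lt`): to order `d − 2` the form
`y ↦ B₀(y, (γ−1)y)` on the dual box IS `−M₂₀·u₀²` — RANK ONE in the single linear coordinate `u₀ = B₀(e₂, u)`, coefficient `−B₀(x,(γ−1)x)`.  So THE SQUARE CLASS OF A CHILD
THROUGH THE LINE `x̄` IS THE CLASS OF `−Q_Ȳ(x̄)`, frame-free (CERT smoke v1.3 §6 «flip», A-p16 (g31)): `P^c → q²·P^{−c}` one level down, a flip of `±` iff `−1 ∉ 𝓀^{×2}`;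
and the depth is EXACTLY `d − 2` at any `u` with `|ϖu₀| = 1` when `|M₂₀| = |ϖ|^d` (`v_B₀_mulVec_eq_of_corner`).  §3 transports to the vertex `κ·L₀` and the element `γ`
(`B₀(κu, (γ−1)κu) = B₀(u, Mu)`, ★ `mem_unitaryGroupOfForm_antidiagonal_iff`): **`|B₀(κu, (γ−1)κu) + u₀²·B₀(κe₀, (γ−1)κe₀)| < |ϖ|^{d−2}`** (`v_B₀_conj_add_sq_mul_B₀_lt`).

* §1 `childFrame_conj_sub_lower_eq`, **`v_childFrame_conj_sub_lower_le`** (second order, every `d`), `childFrame_conj_sub_corner_eq`, **`v_childFrame_conj_sub_corner_le`** (`d ≥ 1`).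
* §2 `v_sigma_mul_self_sub_sq_lt`, **`v_B₀_mulVec_sub_leading_le`**, **`v_B₀_mulVec_add_sq_mul_lt`** (THE TOKEN), `v_B₀_mulVec_eq_of_corner` (exact depth `d − 2`).
* §3 `mulVec_coe_inv_mul_mul`, **`v_B₀_conj_add_sq_mul_B₀_lt`** (the token at `κ·L₀` for `γ`, frame-intrinsic).

HONEST LABEL: HC_CM is proved only modulo the 2 remaining named inputs (hLiu418 24832, h413 24833) until rung 0 closes; nothing printed is asserted here (elementary lattice
algebra over a valuation ring); «S3-ram» has no books consequence.

## References
* [BruhatTits1972] F. Bruhat, J. Tits, *Groupes réductifs sur un corps local I*, Publ. Math. IHÉS 41 (1972), §10 (lattice models; vertex stabilisers and their filtrations).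
* [Tits1979] J. Tits, *Reductive groups over local fields*, PSPM 33.1 (1979), §3.5 (congruence filtration; reduction mod `𝔭` of a parahoric).
* [Kottwitz1986] R. E. Kottwitz, *Base change for unit elements of Hecke algebras*, Compositio Math. 60 (1986), §3 (the level of a fixed lattice; shell recursion).
* [Serre1980Trees] J.-P. Serre, *Trees* (1980), Ch. II §1.1–1.2 (lattices, frames, congruence level of a stabiliser).
-/

set_option autoImplicit false

noncomputable section

open scoped Valued WithZero Matrix MatrixGroups

namespace Literature.NumberTheory.Automorphic.UnitaryLatticeTree

open Literature.NumberTheory.Automorphic Literature.NumberTheory.Automorphic.HermitianLattice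

variable {K : Type*} [Field K] [Valued K ℤᵐ⁰] {σ : K →+* K} {ϖ : K}

/-! ## §1 The conjugate by the child frame to second order -/

omit [Valued K ℤᵐ⁰] in
/-- `g⁻¹Mg − L`, `L` the strictly lower-triangular leading part: the nine remaining entries are integral multiples of entries of `M` (pure algebra, `a, ϖ ≠ 0`).
[cite: Kottwitz1986, §3] [cite: Serre1980Trees, II.1.2] -/
theorem childFrame_conj_sub_lower_eq (hϖ0 : ϖ ≠ 0) {a : K} (ha0 : a ≠ 0) (b : K) (M : Matrix (Fin 3) (Fin 3) K) :
    (!![ϖ / a, 0, 0; 0, 1, 0; -b / a, 0, ϖ⁻¹] : Matrix (Fin 3) (Fin 3) K) * M * !![a / ϖ, 0, 0; 0, 1, 0; b, 0, ϖ] -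
        !![0, 0, 0; (a / ϖ) * M 1 0, 0, 0; (a / ϖ ^ 2) * M 2 0 + (b / ϖ) * (M 2 2 - M 0 0), ϖ⁻¹ * M 2 1, 0] =
      !![M 0 0 + (ϖ * b / a) * M 0 2, (ϖ / a) * M 0 1, (ϖ ^ 2 / a) * M 0 2;
         b * M 1 2, M 1 1, ϖ * M 1 2;
         -((b ^ 2 / a) * M 0 2), -((b / a) * M 0 1), M 2 2 - (ϖ * b / a) * M 0 2] := by
  rw [childFrame_conj_eq hϖ0 ha0]
  ext i j
  fin_cases i <;> fin_cases j
  all_goals simp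

/-- **SECOND-ORDER EXPANSION: every entry of `g⁻¹Mg − L` is `≤ |ϖ|^d`** when `M` has level `ϖ^d` (`|a| = 1`, `|b| ≤ 1`; every `d`), `L = !![0,0,0; (a∕ϖ)M₁₀,0,0;
(a∕ϖ²)M₂₀ + (b∕ϖ)(M₂₂−M₀₀), ϖ⁻¹M₂₁, 0]` — the child's residual matrices of orders `d − 2` and `d − 1` are read off `L`. [cite: Kottwitz1986, §3] [cite: Tits1979, §3.5] -/
theorem v_childFrame_conj_sub_lower_le (hϖ : Valued.v ϖ = WithZero.exp (-1 : ℤ)) {a b : K} (ha : Valued.v a = 1) (hb : Valued.v b ≤ 1)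
    {d : ℕ} {M : Matrix (Fin 3) (Fin 3) K} (hM : ∀ i j, Valued.v (M i j) ≤ Valued.v ϖ ^ d) (i j : Fin 3) :
    Valued.v (((!![ϖ / a, 0, 0; 0, 1, 0; -b / a, 0, ϖ⁻¹] : Matrix (Fin 3) (Fin 3) K) * M * !![a / ϖ, 0, 0; 0, 1, 0; b, 0, ϖ] -
        !![0, 0, 0; (a / ϖ) * M 1 0, 0, 0; (a / ϖ ^ 2) * M 2 0 + (b / ϖ) * (M 2 2 - M 0 0), ϖ⁻¹ * M 2 1, 0]) i j) ≤ Valued.v ϖ ^ d := by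
  have hϖ0 : ϖ ≠ 0 := fun h0 => by rw [h0, map_zero] at hϖ; exact WithZero.coe_ne_zero hϖ.symm
  have ha0 : a ≠ 0 := fun h0 => by rw [h0, map_zero] at ha; exact zero_ne_one ha
  have hϖ1 : Valued.v ϖ ≤ 1 := by rw [hϖ, ← WithZero.exp_zero]; exact WithZero.exp_le_exp.2 (by norm_num)
  have hba : Valued.v (b / a) ≤ 1 := by rw [map_div₀, ha, div_one]; exact hb
  have hϖa : Valued.v (ϖ / a) ≤ 1 := by rw [map_div₀, ha, div_one]; exact hϖ1
  have hϖba : Valued.v (ϖ * b / a) ≤ 1 := by rw [map_div₀, map_mul, ha, div_one]; exact mul_le_one' hϖ1 hb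
  have hϖ2a : Valued.v (ϖ ^ 2 / a) ≤ 1 := by rw [map_div₀, map_pow, ha, div_one]; exact pow_le_one₀ zero_le hϖ1
  have hb2a : Valued.v (b ^ 2 / a) ≤ 1 := by rw [map_div₀, map_pow, ha, div_one]; exact pow_le_one₀ zero_le hb
  have hmul1 : ∀ {c x : K} {t : ℤᵐ⁰}, Valued.v c ≤ 1 → Valued.v x ≤ t → Valued.v (c * x) ≤ t := fun {c x t} hc hx => by
    rw [map_mul]; exact (mul_le_of_le_one_left zero_le hc).trans hx
  rw [childFrame_conj_sub_lower_eq hϖ0 ha0]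
  fin_cases i <;> fin_cases j
  · simpa using (Valuation.map_add _ _ _).trans (max_le (hM 0 0) (hmul1 hϖba (hM 0 2)))
  · simpa using hmul1 hϖa (hM 0 1)
  · simpa using hmul1 hϖ2a (hM 0 2)
  · simpa using hmul1 hb (hM 1 2)
  · simpa using hM 1 1
  · simpa using hmul1 hϖ1 (hM 1 2)
  · simpa using hmul1 hb2a (hM 0 2)
  · simpa using hmul1 hba (hM 0 1)
  · simpa using (Valuation.map_sub _ _ _).trans (max_le (hM 2 2) (hmul1 hϖba (hM 0 2)))

omit [Valued K ℤᵐ⁰] in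
/-- `g⁻¹Mg − (a∕ϖ²)M₂₀·E₂₀`: the nine remaining entries (pure algebra, `a, ϖ ≠ 0`). [cite: Kottwitz1986, §3] [cite: Serre1980Trees, II.1.2] -/
theorem childFrame_conj_sub_corner_eq (hϖ0 : ϖ ≠ 0) {a : K} (ha0 : a ≠ 0) (b : K) (M : Matrix (Fin 3) (Fin 3) K) :
    (!![ϖ / a, 0, 0; 0, 1, 0; -b / a, 0, ϖ⁻¹] : Matrix (Fin 3) (Fin 3) K) * M * !![a / ϖ, 0, 0; 0, 1, 0; b, 0, ϖ] -
        !![0, 0, 0; 0, 0, 0; (a / ϖ ^ 2) * M 2 0, 0, 0] =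
      !![M 0 0 + (ϖ * b / a) * M 0 2, (ϖ / a) * M 0 1, (ϖ ^ 2 / a) * M 0 2;
         (a / ϖ) * M 1 0 + b * M 1 2, M 1 1, ϖ * M 1 2;
         (b / ϖ) * (M 2 2 - M 0 0) - (b ^ 2 / a) * M 0 2, ϖ⁻¹ * M 2 1 - (b / a) * M 0 1, M 2 2 - (ϖ * b / a) * M 0 2] := by
  rw [childFrame_conj_eq hϖ0 ha0]
  ext i j
  fin_cases i <;> fin_cases j
  all_goals simp
  all_goals ring

/-- **FIRST-ORDER EXPANSION: every entry of `g⁻¹Mg − (a∕ϖ²)M₂₀·E₂₀` is `≤ |ϖ|^{d−1}`** when `M` has level `ϖ^d`, `d ≥ 1` (`|a| = 1`, `|b| ≤ 1`): the child's residual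
matrix of order `d − 2` is the CORNER `(aϖ^{−d}M₂₀)·E₂₀` — rank at most one, corner type. [cite: Kottwitz1986, §3] [cite: Tits1979, §3.5] -/
theorem v_childFrame_conj_sub_corner_le (hϖ : Valued.v ϖ = WithZero.exp (-1 : ℤ)) {a b : K} (ha : Valued.v a = 1) (hb : Valued.v b ≤ 1)
    {d : ℕ} (hd : 1 ≤ d) {M : Matrix (Fin 3) (Fin 3) K} (hM : ∀ i j, Valued.v (M i j) ≤ Valued.v ϖ ^ d) (i j : Fin 3) :
    Valued.v (((!![ϖ / a, 0, 0; 0, 1, 0; -b / a, 0, ϖ⁻¹] : Matrix (Fin 3) (Fin 3) K) * M * !![a / ϖ, 0, 0; 0, 1, 0; b, 0, ϖ] -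
        !![0, 0, 0; 0, 0, 0; (a / ϖ ^ 2) * M 2 0, 0, 0]) i j) ≤ Valued.v ϖ ^ (d - 1) := by
  have hϖ0 : ϖ ≠ 0 := fun h0 => by rw [h0, map_zero] at hϖ; exact WithZero.coe_ne_zero hϖ.symm
  have hvϖ0 : Valued.v ϖ ≠ 0 := (Valuation.ne_zero_iff _).2 hϖ0
  have ha0 : a ≠ 0 := fun h0 => by rw [h0, map_zero] at ha; exact zero_ne_one ha
  have hϖ1 : Valued.v ϖ ≤ 1 := by rw [hϖ, ← WithZero.exp_zero]; exact WithZero.exp_le_exp.2 (by norm_num)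
  have hpow : ∀ {m n : ℕ}, n ≤ m → Valued.v ϖ ^ m ≤ Valued.v ϖ ^ n := fun {m n} h => pow_le_pow_right_of_le_one' hϖ1 h
  have hd1 : Valued.v ϖ ^ d = Valued.v ϖ * Valued.v ϖ ^ (d - 1) := by rw [← pow_succ']; congr 1; omega
  have hM' : ∀ i j, Valued.v (M i j) ≤ Valued.v ϖ ^ (d - 1) := fun i j => (hM i j).trans (hpow (by omega))
  have hba : Valued.v (b / a) ≤ 1 := by rw [map_div₀, ha, div_one]; exact hb
  have hϖa : Valued.v (ϖ / a) ≤ 1 := by rw [map_div₀, ha, div_one]; exact hϖ1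
  have hϖba : Valued.v (ϖ * b / a) ≤ 1 := by rw [map_div₀, map_mul, ha, div_one]; exact mul_le_one' hϖ1 hb
  have hϖ2a : Valued.v (ϖ ^ 2 / a) ≤ 1 := by rw [map_div₀, map_pow, ha, div_one]; exact pow_le_one₀ zero_le hϖ1
  have hb2a : Valued.v (b ^ 2 / a) ≤ 1 := by rw [map_div₀, map_pow, ha, div_one]; exact pow_le_one₀ zero_le hb
  have hmul1 : ∀ {c x : K} {t : ℤᵐ⁰}, Valued.v c ≤ 1 → Valued.v x ≤ t → Valued.v (c * x) ≤ t := fun {c x t} hc hx => by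
    rw [map_mul]; exact (mul_le_of_le_one_left zero_le hc).trans hx
  have hsc1 : ∀ {x : K}, Valued.v x ≤ Valued.v ϖ ^ d → Valued.v (ϖ⁻¹ * x) ≤ Valued.v ϖ ^ (d - 1) := fun {x} hx => by
    rw [map_mul, map_inv₀]
    calc (Valued.v ϖ)⁻¹ * Valued.v x ≤ (Valued.v ϖ)⁻¹ * Valued.v ϖ ^ d := mul_le_mul' le_rfl hx
      _ = Valued.v ϖ ^ (d - 1) := by rw [hd1, ← mul_assoc, inv_mul_cancel₀ hvϖ0, one_mul]
  have h10 : Valued.v (a / ϖ * M 1 0) ≤ Valued.v ϖ ^ (d - 1) := by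
    have : a / ϖ * M 1 0 = a * (ϖ⁻¹ * M 1 0) := by field_simp
    rw [this, map_mul, ha, one_mul]; exact hsc1 (hM 1 0)
  have hbϖ : Valued.v (b / ϖ * (M 2 2 - M 0 0)) ≤ Valued.v ϖ ^ (d - 1) := by
    have : b / ϖ * (M 2 2 - M 0 0) = b * (ϖ⁻¹ * (M 2 2 - M 0 0)) := by field_simp
    rw [this]
    exact hmul1 hb (hsc1 ((Valuation.map_sub _ _ _).trans (max_le (hM 2 2) (hM 0 0))))
  have h21 : Valued.v (ϖ⁻¹ * M 2 1) ≤ Valued.v ϖ ^ (d - 1) := hsc1 (hM 2 1)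
  rw [childFrame_conj_sub_corner_eq hϖ0 ha0]
  fin_cases i <;> fin_cases j
  · simpa using (Valuation.map_add _ _ _).trans (max_le (hM' 0 0) (hmul1 hϖba (hM' 0 2)))
  · simpa using hmul1 hϖa (hM' 0 1)
  · simpa using hmul1 hϖ2a (hM' 0 2)
  · simpa using (Valuation.map_add _ _ _).trans (max_le h10 (hmul1 hb (hM' 1 2)))
  · simpa using hM' 1 1
  · simpa using hmul1 hϖ1 (hM' 1 2)
  · simpa using (Valuation.map_sub _ _ _).trans (max_le hbϖ (hmul1 hb2a (hM' 0 2)))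
  · simpa using (Valuation.map_sub _ _ _).trans (max_le h21 (hmul1 hba (hM' 0 1)))
  · simpa using (Valuation.map_sub _ _ _).trans (max_le (hM' 2 2) (hmul1 hϖba (hM' 0 2)))

/-! ## §2 The form on the dual box: the token -/

/-- **Norms are residual squares at a tame-ramified place**: `|σz·z − z²| < 1` for `|z| ≤ 1` when `σ` is residually trivial (`σz·z − z² = (σz − z)·z`).
[cite: Tits1979, §3.5] [cite: BruhatTits1972, §10] -/
theorem v_sigma_mul_self_sub_sq_lt (hres : ∀ x : K, Valued.v x ≤ 1 → Valued.v (σ x - x) < 1) {z : K} (hz : Valued.v z ≤ 1) :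
    Valued.v (σ z * z - z ^ 2) < 1 := by
  have e : σ z * z - z ^ 2 = (σ z - z) * z := by ring
  rw [e, map_mul]
  exact (mul_le_of_le_one_right' hz).trans_lt (hres z hz)

/-- **The form at a vector of the dual box, to first order**: for `M` of level `ϖ^d` (`d ≥ 1`), `σ` valuation-preserving and `u` with `|ϖu₀| ≤ 1`, `|u₁| ≤ 1`, `|u₂| ≤ 1`
(`u ∈ N₁^♯ = latt diag(ϖ⁻¹,1,1)`): `|B₀(u, Mu) − σ(u₀)u₀·M₂₀| ≤ |ϖ|^{d−1}` (the eight other terms of `Σ σ(u_i)M_{2−i,j}u_j` have at most one factor of size `|ϖ|⁻¹`).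
[cite: Kottwitz1986, §3] [cite: BruhatTits1972, §10] -/
theorem v_B₀_mulVec_sub_leading_le (hvσ : ∀ z, Valued.v (σ z) = Valued.v z) (hϖ : Valued.v ϖ = WithZero.exp (-1 : ℤ))
    {d : ℕ} (hd : 1 ≤ d) {M : Matrix (Fin 3) (Fin 3) K} (hM : ∀ i j, Valued.v (M i j) ≤ Valued.v ϖ ^ d)
    {u : Fin 3 → K} (hu0 : Valued.v (ϖ * u 0) ≤ 1) (hu1 : Valued.v (u 1) ≤ 1) (hu2 : Valued.v (u 2) ≤ 1) :
    Valued.v (B₀ σ 3 u (M.mulVec u) - σ (u 0) * u 0 * M 2 0) ≤ Valued.v ϖ ^ (d - 1) := by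
  have hϖ0 : ϖ ≠ 0 := fun h0 => by rw [h0, map_zero] at hϖ; exact WithZero.coe_ne_zero hϖ.symm
  have hvϖ0 : Valued.v ϖ ≠ 0 := (Valuation.ne_zero_iff _).2 hϖ0
  have hϖ1 : Valued.v ϖ ≤ 1 := by rw [hϖ, ← WithZero.exp_zero]; exact WithZero.exp_le_exp.2 (by norm_num)
  have hpow : ∀ {m n : ℕ}, n ≤ m → Valued.v ϖ ^ m ≤ Valued.v ϖ ^ n := fun {m n} h => pow_le_pow_right_of_le_one' hϖ1 h
  have hd1 : Valued.v ϖ ^ d = Valued.v ϖ * Valued.v ϖ ^ (d - 1) := by rw [← pow_succ']; congr 1; omega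
  have hM' : ∀ i j, Valued.v (M i j) ≤ Valued.v ϖ ^ (d - 1) := fun i j => (hM i j).trans (hpow (by omega))
  -- `|u₀| ≤ |ϖ|⁻¹`
  have hu0' : Valued.v (u 0) ≤ (Valued.v ϖ)⁻¹ := by
    have e : u 0 = ϖ⁻¹ * (ϖ * u 0) := by field_simp
    rw [e, map_mul, map_inv₀]; exact mul_le_of_le_one_right' hu0
  have hmul1 : ∀ {c x : K} {t : ℤᵐ⁰}, Valued.v c ≤ 1 → Valued.v x ≤ t → Valued.v (c * x) ≤ t := fun {c x t} hc hx => by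
    rw [map_mul]; exact (mul_le_of_le_one_left zero_le hc).trans hx
  have hmulr : ∀ {c x : K} {t : ℤᵐ⁰}, Valued.v c ≤ 1 → Valued.v x ≤ t → Valued.v (x * c) ≤ t := fun {c x t} hc hx => by
    rw [mul_comm]; exact hmul1 hc hx
  -- a level-`ϖ^d` entry times `u₀` is `≤ |ϖ|^(d-1)`
  have hsc : ∀ {x : K}, Valued.v x ≤ Valued.v ϖ ^ d → Valued.v (x * u 0) ≤ Valued.v ϖ ^ (d - 1) := fun {x} hx => by
    rw [map_mul]
    calc Valued.v x * Valued.v (u 0) ≤ Valued.v ϖ ^ d * (Valued.v ϖ)⁻¹ := mul_le_mul' hx hu0'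
      _ = Valued.v ϖ ^ (d - 1) := by rw [hd1, mul_comm (Valued.v ϖ), mul_assoc, mul_inv_cancel₀ hvϖ0, mul_one]
  have hrow : ∀ i, Valued.v (M i 0 * u 0 + M i 1 * u 1 + M i 2 * u 2) ≤ Valued.v ϖ ^ (d - 1) := fun i =>
    (Valuation.map_add _ _ _).trans (max_le ((Valuation.map_add _ _ _).trans (max_le (hsc (hM i 0)) (hmulr hu1 (hM' i 1)))) (hmulr hu2 (hM' i 2)))
  have hrow2 : Valued.v (M 2 1 * u 1 + M 2 2 * u 2) ≤ Valued.v ϖ ^ d :=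
    (Valuation.map_add _ _ _).trans (max_le (hmulr hu1 (hM 2 1)) (hmulr hu2 (hM 2 2)))
  have e : B₀ σ 3 u (M.mulVec u) - σ (u 0) * u 0 * M 2 0 =
      σ (u 0) * (M 2 1 * u 1 + M 2 2 * u 2) + σ (u 1) * (M 1 0 * u 0 + M 1 1 * u 1 + M 1 2 * u 2) + σ (u 2) * (M 0 0 * u 0 + M 0 1 * u 1 + M 0 2 * u 2) := by
    rw [B₀_apply]
    simp [Matrix.mulVec, dotProduct, Fin.sum_univ_three, Fin.rev]
    ring
  rw [e]
  refine (Valuation.map_add _ _ _).trans (max_le ((Valuation.map_add _ _ _).trans (max_le ?_ ?_)) ?_)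
  · rw [map_mul, hvσ]
    calc Valued.v (u 0) * Valued.v (M 2 1 * u 1 + M 2 2 * u 2) ≤ (Valued.v ϖ)⁻¹ * Valued.v ϖ ^ d := mul_le_mul' hu0' hrow2
      _ = Valued.v ϖ ^ (d - 1) := by rw [hd1, ← mul_assoc, inv_mul_cancel₀ hvϖ0, one_mul]
  · rw [map_mul, hvσ]; exact (mul_le_of_le_one_left zero_le hu1).trans (hrow 1)
  · rw [map_mul, hvσ]; exact (mul_le_of_le_one_left zero_le hu2).trans (hrow 0)

/-- **THE TOKEN.**  For `M` of level `ϖ^d` (`d ≥ 2`), `σ` valuation-preserving with `σϖ = −ϖ` and residually trivial, and `u` in the dual box (`|ϖu₀| ≤ 1`, `|u₁|, |u₂| ≤ 1`):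
**`|B₀(u, Mu) + u₀²·M₂₀| < |ϖ|^{d−2}`** — to order `d − 2` the form `u ↦ B₀(u, Mu)` on the dual box is `−M₂₀·u₀²`: rank one in the linear coordinate `u₀`, coefficient
`−M₂₀ = −B₀(x, (γ−1)x)`; the square class of every child through the line is the class of `−M₂₀ϖ^{−d}` (`σ(u₀)u₀ = −N(ϖu₀)∕ϖ²` and `N(ϖu₀) ≡ (ϖu₀)²`).
[cite: Kottwitz1986, §3] [cite: Tits1979, §3.5] [cite: BruhatTits1972, §10] -/
theorem v_B₀_mulVec_add_sq_mul_lt (hvσ : ∀ z, Valued.v (σ z) = Valued.v z) (hσϖ : σ ϖ = -ϖ) (hϖ : Valued.v ϖ = WithZero.exp (-1 : ℤ))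
    (hres : ∀ x : K, Valued.v x ≤ 1 → Valued.v (σ x - x) < 1)
    {d : ℕ} (hd : 2 ≤ d) {M : Matrix (Fin 3) (Fin 3) K} (hM : ∀ i j, Valued.v (M i j) ≤ Valued.v ϖ ^ d)
    {u : Fin 3 → K} (hu0 : Valued.v (ϖ * u 0) ≤ 1) (hu1 : Valued.v (u 1) ≤ 1) (hu2 : Valued.v (u 2) ≤ 1) :
    Valued.v (B₀ σ 3 u (M.mulVec u) + u 0 ^ 2 * M 2 0) < Valued.v ϖ ^ (d - 2) := by
  have hϖ0 : ϖ ≠ 0 := fun h0 => by rw [h0, map_zero] at hϖ; exact WithZero.coe_ne_zero hϖ.symm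
  have hvϖ0 : Valued.v ϖ ≠ 0 := (Valuation.ne_zero_iff _).2 hϖ0
  have hϖlt : Valued.v ϖ < 1 := by rw [hϖ, ← WithZero.exp_zero]; exact WithZero.exp_lt_exp.2 (by norm_num)
  have hd1 : Valued.v ϖ ^ (d - 1) = Valued.v ϖ * Valued.v ϖ ^ (d - 2) := by rw [← pow_succ']; congr 1; omega
  have hd2 : Valued.v ϖ ^ d = Valued.v ϖ ^ 2 * Valued.v ϖ ^ (d - 2) := by rw [← pow_add]; congr 1; omega
  have hne : Valued.v ϖ ^ (d - 2) ≠ 0 := pow_ne_zero _ hvϖ0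
  -- `|u₀| ≤ |ϖ|⁻¹`
  have hu0' : Valued.v (u 0) ≤ (Valued.v ϖ)⁻¹ := by
    have e : u 0 = ϖ⁻¹ * (ϖ * u 0) := by field_simp
    rw [e, map_mul, map_inv₀]; exact mul_le_of_le_one_right' hu0
  -- first-order part, strictly below `|ϖ|^(d-2)`
  have h1 : Valued.v (B₀ σ 3 u (M.mulVec u) - σ (u 0) * u 0 * M 2 0) < Valued.v ϖ ^ (d - 2) := by
    refine (v_B₀_mulVec_sub_leading_le hvσ hϖ (by omega) hM hu0 hu1 hu2).trans_lt ?_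
    rw [hd1]
    exact mul_lt_of_lt_one_left (zero_lt_iff.2 hne) hϖlt
  -- the norm correction: `σ(u₀)u₀ + u₀² = −u₀ϖ⁻¹·(σ(ϖu₀) − ϖu₀)`, of size `< |ϖ|⁻²`
  have h2 : Valued.v (σ (u 0) * u 0 + u 0 ^ 2) < (Valued.v ϖ ^ 2)⁻¹ := by
    have e : σ (u 0) * u 0 + u 0 ^ 2 = -(u 0 * ϖ⁻¹ * (σ (ϖ * u 0) - ϖ * u 0)) := by
      rw [map_mul, hσϖ]; field_simp; ring
    rw [e, Valuation.map_neg, map_mul, map_mul, map_inv₀]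
    calc Valued.v (u 0) * (Valued.v ϖ)⁻¹ * Valued.v (σ (ϖ * u 0) - ϖ * u 0)
        < (Valued.v ϖ)⁻¹ * (Valued.v ϖ)⁻¹ * 1 :=
          mul_lt_mul_of_le_of_lt_of_nonneg_of_pos (mul_le_mul' hu0' le_rfl) (hres _ hu0) zero_le
            (zero_lt_iff.2 (mul_ne_zero (inv_ne_zero hvϖ0) (inv_ne_zero hvϖ0)))
      _ = (Valued.v ϖ ^ 2)⁻¹ := by rw [mul_one, ← mul_inv, ← pow_two]
  have h3 : Valued.v ((σ (u 0) * u 0 + u 0 ^ 2) * M 2 0) < Valued.v ϖ ^ (d - 2) := by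
    rw [map_mul, mul_comm]
    calc Valued.v (M 2 0) * Valued.v (σ (u 0) * u 0 + u 0 ^ 2) < Valued.v ϖ ^ d * (Valued.v ϖ ^ 2)⁻¹ :=
          mul_lt_mul_of_le_of_lt_of_nonneg_of_pos (hM 2 0) h2 zero_le (zero_lt_iff.2 (pow_ne_zero _ hvϖ0))
      _ = Valued.v ϖ ^ (d - 2) := by rw [hd2, mul_comm (Valued.v ϖ ^ 2), mul_assoc, mul_inv_cancel₀ (pow_ne_zero _ hvϖ0), mul_one]
  have e : B₀ σ 3 u (M.mulVec u) + u 0 ^ 2 * M 2 0 = (B₀ σ 3 u (M.mulVec u) - σ (u 0) * u 0 * M 2 0) + (σ (u 0) * u 0 + u 0 ^ 2) * M 2 0 := by ring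
  rw [e]
  exact Valuation.map_add_lt _ h1 h3

/-- **Exact depth `d − 2`**: if moreover the corner is a unit multiple of `ϖ^d` (`|M₂₀| = |ϖ|^d`) and `|ϖu₀| = 1`, then `|B₀(u, Mu)| = |ϖ|^{d−2}` — the level of `γ` at a
child through a line where the residual form does not vanish is EXACTLY `d − 2`, witnessed at its generator. [cite: Kottwitz1986, §3] [cite: Tits1979, §3.5] -/
theorem v_B₀_mulVec_eq_of_corner (hvσ : ∀ z, Valued.v (σ z) = Valued.v z) (hσϖ : σ ϖ = -ϖ) (hϖ : Valued.v ϖ = WithZero.exp (-1 : ℤ))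
    (hres : ∀ x : K, Valued.v x ≤ 1 → Valued.v (σ x - x) < 1)
    {d : ℕ} (hd : 2 ≤ d) {M : Matrix (Fin 3) (Fin 3) K} (hM : ∀ i j, Valued.v (M i j) ≤ Valued.v ϖ ^ d) (h20 : Valued.v (M 2 0) = Valued.v ϖ ^ d)
    {u : Fin 3 → K} (hu0 : Valued.v (ϖ * u 0) = 1) (hu1 : Valued.v (u 1) ≤ 1) (hu2 : Valued.v (u 2) ≤ 1) :
    Valued.v (B₀ σ 3 u (M.mulVec u)) = Valued.v ϖ ^ (d - 2) := by
  have hϖ0 : ϖ ≠ 0 := fun h0 => by rw [h0, map_zero] at hϖ; exact WithZero.coe_ne_zero hϖ.symm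
  have hvϖ0 : Valued.v ϖ ≠ 0 := (Valuation.ne_zero_iff _).2 hϖ0
  have hd2 : Valued.v ϖ ^ d = Valued.v ϖ ^ 2 * Valued.v ϖ ^ (d - 2) := by rw [← pow_add]; congr 1; omega
  have hu0v : Valued.v (u 0) = (Valued.v ϖ)⁻¹ := by
    have e : u 0 = ϖ⁻¹ * (ϖ * u 0) := by field_simp
    rw [e, map_mul, map_inv₀, hu0, mul_one]
  have hsq : Valued.v (-(u 0 ^ 2 * M 2 0)) = Valued.v ϖ ^ (d - 2) := by
    rw [Valuation.map_neg, map_mul, map_pow, hu0v, h20, hd2, ← mul_assoc, inv_pow, inv_mul_cancel₀ (pow_ne_zero _ hvϖ0), one_mul]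
  have hlt := v_B₀_mulVec_add_sq_mul_lt hvσ hσϖ hϖ hres hd hM hu0.le hu1 hu2
  have e : B₀ σ 3 u (M.mulVec u) = (B₀ σ 3 u (M.mulVec u) + u 0 ^ 2 * M 2 0) + -(u 0 ^ 2 * M 2 0) := by ring
  rw [e, Valuation.map_add_eq_of_lt_right _ (hlt.trans_eq hsq.symm), hsq]

/-! ## §3 Transport to the vertex `κ·L₀` and the element `γ` -/

omit [Valued K ℤᵐ⁰] in
/-- `(γ − 1)·(κu) = κ·(Mu)` for `M = κ⁻¹(γ−1)κ`. [cite: Tits1979, §3.5] -/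
theorem mulVec_coe_inv_mul_mul (κ : unitaryGroupOfForm σ ((StdForm.antidiagonal 3).over K)) (Y : Matrix (Fin 3) (Fin 3) K) (u : Fin 3 → K) :
    Y.mulVec (((κ : GL (Fin 3) K) : Matrix (Fin 3) (Fin 3) K).mulVec u) =
      ((κ : GL (Fin 3) K) : Matrix (Fin 3) (Fin 3) K).mulVec
        (((((κ : GL (Fin 3) K)⁻¹ : GL (Fin 3) K) : Matrix (Fin 3) (Fin 3) K) * Y * ((κ : GL (Fin 3) K) : Matrix (Fin 3) (Fin 3) K)).mulVec u) := by
  rw [Matrix.mulVec_mulVec, Matrix.mulVec_mulVec, ← Matrix.mul_assoc, ← Matrix.mul_assoc, Units.mul_inv, Matrix.one_mul]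

/-- **THE TOKEN AT THE VERTEX `κ·L₀`, FRAME-INTRINSIC.**  For unitary `κ` and a matrix `Y` (the `γ − 1` of an element fixing `κ·L₀`) with `κ⁻¹Yκ` of level `ϖ^d`, `d ≥ 2`,
and every `u` of the dual box: **`|B₀(κu, Y·κu) + u₀²·B₀(κe₀, Y·κe₀)| < |ϖ|^{d−2}`** — on `κ·N₁^♯ ⊇` every child through the line `x̄`, `x = κe₀`, the form
`y ↦ B₀(y, (γ−1)y)` is `−B₀(x,(γ−1)x)·u₀²` to order `d − 2` (`u₀ = B₀(κe₂, y)`): the child's square class is that of `−Q_Ȳ(x̄)`.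
[cite: Kottwitz1986, §3] [cite: BruhatTits1972, §10] [cite: Tits1979, §3.5] -/
theorem v_B₀_conj_add_sq_mul_B₀_lt (hvσ : ∀ z, Valued.v (σ z) = Valued.v z) (hσϖ : σ ϖ = -ϖ) (hϖ : Valued.v ϖ = WithZero.exp (-1 : ℤ))
    (hres : ∀ x : K, Valued.v x ≤ 1 → Valued.v (σ x - x) < 1)
    (κ : unitaryGroupOfForm σ ((StdForm.antidiagonal 3).over K)) (Y : Matrix (Fin 3) (Fin 3) K) {d : ℕ} (hd : 2 ≤ d)
    (hM : ∀ i j, Valued.v (((((κ : GL (Fin 3) K)⁻¹ : GL (Fin 3) K) : Matrix (Fin 3) (Fin 3) K) * Y * ((κ : GL (Fin 3) K) : Matrix (Fin 3) (Fin 3) K)) i j) ≤ Valued.v ϖ ^ d)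
    {u : Fin 3 → K} (hu0 : Valued.v (ϖ * u 0) ≤ 1) (hu1 : Valued.v (u 1) ≤ 1) (hu2 : Valued.v (u 2) ≤ 1) :
    Valued.v (B₀ σ 3 (((κ : GL (Fin 3) K) : Matrix (Fin 3) (Fin 3) K).mulVec u) (Y.mulVec (((κ : GL (Fin 3) K) : Matrix (Fin 3) (Fin 3) K).mulVec u)) +
        u 0 ^ 2 * B₀ σ 3 (fun i => ((κ : GL (Fin 3) K) : Matrix (Fin 3) (Fin 3) K) i 0) (Y.mulVec (fun i => ((κ : GL (Fin 3) K) : Matrix (Fin 3) (Fin 3) K) i 0))) <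
      Valued.v ϖ ^ (d - 2) := by
  have hκu := (mem_unitaryGroupOfForm_antidiagonal_iff (κ : GL (Fin 3) K)).1 κ.2
  rw [mulVec_coe_inv_mul_mul, hκu, ← inv_mul_mul_apply_two_zero_eq_B₀ κ Y]
  exact v_B₀_mulVec_add_sq_mul_lt hvσ hσϖ hϖ hres hd hM hu0 hu1 hu2

end Literature.NumberTheory.Automorphic.UnitaryLatticeTree

end
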